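import Summits.BirchSwinnertonDyer.BirchSwinnertonDyer.Theorems.ThetaPartnerAtTwoSignedControlAtTwoMuRealTrivialCoefficients
import Summits.BirchSwinnertonDyer.BirchSwinnertonDyer.Theorems.KolyvaginRoadThreePTDevissageUnipotentTwoFinal
import HarnessLib

/-!
# Milne *ADT* I Thm. 4.10(b) `Ker γ¹ ⊆ Im β¹` for every 2-dimensional UNIPOTENT `𝔽ₚ`-module over a number field
# containing `μₚ` — REAL places included (`p = 2`, every number field)

Route `ThetaPartnerAtTwo`, crux K4 `SignedControlAtTwo` (stmt-BirchSwinnertonDyer-20309), line `eulerchar` v10, lead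
`bsd-wall-tp2-p3` g4 (`--supports stmt-BirchSwinnertonDyer-20309`, helper).  File 4 of the real-place packet
(`…MuRealKummer`, `…MuRealMiddleExact`, `…MuRealTrivialCoefficients`).

bsd-stepL koly's `middleExact_canonical_of_unipotentTwo_all` (Milne I 4.10(b) for `0 → A → M → B → 0` with `A`, `B`
trivial of order `p`, `K ∋ μₚ`, THE invariant maps, every admissible `S`) carries the archimedean hypothesis
`∀ w, w.IsReal → Odd p` ONLY through its three calls to the trivial base case
`middleExact_canonical_of_trivial_of_card_eq`; the dévissage (`middleExact_canonical_of_extension`), the shrinking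
argument, `Ш¹ = 0` for trivial modules of prime order over `K ∋ μₚ`, and `middleExact_canonical_of_superset` are
parity-free.  Feeding the real-place base case `middleExact_canonical_of_trivial_of_card_eq_real` (file 3) gives:

* **`middleExact_canonical_of_unipotentTwo_all_real`** — the same statement WITHOUT `harch`.  At `p = 2` (where
  `ζ = -1 ∈ K` always): Milne I 4.10(b) for every `Γ_K`-module `M` of order `4` killed by `2` that is an extension
  of `ℤ/2` by `ℤ/2`, over EVERY number field — e.g. `E[2]` over `ℚ` for every elliptic curve with a rational
  `2`-torsion point (`0 → ⟨P⟩ → E[2] → E[2]/⟨P⟩ → 0`).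

HONEST FRAMING. THEOREMS ONLY; the proof is koly g20's, verbatim, with the base case swapped; the prime-to-`p`
DESCENT with real places (needed for `E[2]` over `ℚ` when `ℚ(E[2])/ℚ` has degree `3` or `6`, K4's habitat) is NOT
here; no item closes; BSD is not proved by any of this.

References: [MilneADT2006] I Thm. 4.10(b), Lemma 4.8; [NeukirchSchmidtWingberg2008] (8.3.20); [Harari2020] Thm. 18.9.
-/

noncomputable section

open CategoryTheory Function NumberField IsDedekindDomain
open scoped NumberField ContRepresentation

set_option linter.dupNamespace false
set_option autoImplicit false

namespace Summit.BirchSwinnertonDyer.BirchSwinnertonDyer.Theorems.SignedEC.MuReal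

open Field
open Literature.NumberTheory.GaloisRepresentations Literature.NumberTheory.GaloisCohomology
open Literature.NumberTheory.GaloisRepresentations.DiscreteGaloisModule (mu MuCarrier TateDual tateDual
  localTatePairingZMod homOfIntertwining unramifiedSubgroup SelmerStructure)
open _root_.TopRep _root_.ContRepresentation _root_.ContinuousCohomology
open Summit.BirchSwinnertonDyer.BirchSwinnertonDyer.Theorems.SchneiderFreeAdditiveX3.PoitouTateReduction
open Summit.BirchSwinnertonDyer.BirchSwinnertonDyer.Theorems.KolyvaginRoadThreePT
open Summit.BirchSwinnertonDyer.Rank1Residual.GaloisImage.SelmerFinite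

variable {K : Type} [Field K] [NumberField K] {p : ℕ} [hp : Fact p.Prime]
variable {A M B : Type}
  [AddCommGroup A] [TopologicalSpace A] [DiscreteTopology A] [Finite A]
  [AddCommGroup M] [TopologicalSpace M] [DiscreteTopology M] [Finite M]
  [AddCommGroup B] [TopologicalSpace B] [DiscreteTopology B] [Finite B]

/-- **Milne I Thm. 4.10(b) for every 2-dimensional UNIPOTENT `𝔽ₚ`-module over `K ∋ μₚ`, THE invariant maps, EVERY
admissible `S`, EVERY number field (real places allowed, `p = 2` allowed)**: koly's
`middleExact_canonical_of_unipotentTwo_all` with its base case replaced by `middleExact_canonical_of_trivial_of_card_eq_real`.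
[cite: MilneADT2006, Ch. I, Thm. 4.10(b)] [cite: NeukirchSchmidtWingberg2008, (8.3.20)] -/
theorem middleExact_canonical_of_unipotentTwo_all_real [Finite (TateDual K B p)]
    {ζ : K} (hζ : IsPrimitiveRoot ζ p)
    (ρA : DiscreteGaloisModule K A) (ρ : DiscreteGaloisModule K M) (ρB : DiscreteGaloisModule K B)
    (hA : ∀ (σ : absoluteGaloisGroup K) (a : A), ρA σ a = a)
    (hB : ∀ (σ : absoluteGaloisGroup K) (b : B), ρB σ b = b)
    (hcardA : Nat.card A = p) (hcardB : Nat.card B = p)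
    (hpA : ∀ a : A, p • a = 0) (hpM : ∀ m : M, p • m = 0) (hpB : ∀ b : B, p • b = 0)
    {f : ρA.toContRepresentation →ⁱL ρ.toContRepresentation}
    {g : ρ.toContRepresentation →ⁱL ρB.toContRepresentation}
    (h : IsSES (homOfIntertwining f) (homOfIntertwining g))
    {S : Finset (Place K)} (hSinf : ∀ w : InfinitePlace K, (Sum.inl w : Place K) ∈ S)
    (hS : ∀ v : HeightOneSpectrum (𝓞 K), (Sum.inr v : Place K) ∉ S →
      ((p : ℕ) : 𝓞 K) ∉ v.asIdeal ∧ GaloisRep.IsUnramifiedAt v ρ)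
    (t : Π v : Place K, galoisCohomology (ρ.toLocal v) 1)
    (horth : ∀ y : galoisCohomology (ρ.tateDual p) 1,
      (∀ v : HeightOneSpectrum (𝓞 K), (Sum.inr v : Place K) ∉ S →
        galoisCohomology.localization (ρ.tateDual p) (Sum.inr v) 1 y ∈
          unramifiedSubgroup (GaloisRep.toLocal v (ρ.tateDual p)) 1) →
      ∑ v ∈ S, localTatePairingZMod ρ p v (LocalInvariants.canonical K p v) (t v)
        (galoisCohomology.localization (ρ.tateDual p) v 1 y) = 0) :
    ∃ x : galoisCohomology ρ 1,
      (∀ v : HeightOneSpectrum (𝓞 K), (Sum.inr v : Place K) ∉ S →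
        galoisCohomology.localization ρ (Sum.inr v) 1 x ∈ unramifiedSubgroup (GaloisRep.toLocal v ρ) 1) ∧
      ∀ v ∈ S, galoisCohomology.localization ρ v 1 x = t v := by
  classical
  haveI : NeZero p := ⟨hp.out.ne_zero⟩
  have hμ : ∀ (σ : absoluteGaloisGroup K) (w : MuCarrier K p), mu K p σ w = w :=
    mu_apply_eq_self_of_isPrimitiveRoot K hζ
  -- the two trivial modules `A^D`, `B^{DD}` of order `p`
  have hAD : ∀ (σ : absoluteGaloisGroup K) (φ : TateDual K A p), ρA.tateDual p σ φ = φ :=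
    tateDual_apply_eq_self_of_trivial p ρA hA hμ
  have hcardAD : Nat.card (TateDual K A p) = p := (HomCarrier.natCard_eq (muEquivZMod K p) hpA).trans hcardA
  have hBD : ∀ (σ : absoluteGaloisGroup K) (φ : TateDual K B p), ρB.tateDual p σ φ = φ :=
    tateDual_apply_eq_self_of_trivial p ρB hB hμ
  have hpBD : ∀ φ : TateDual K B p, p • φ = 0 := fun φ => DiscreteGaloisModule.TateDual.nsmul_eq_zero φ
  have hcardBD : Nat.card (TateDual K B p) = p := (HomCarrier.natCard_eq (muEquivZMod K p) hpB).trans hcardB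
  have hBDD : ∀ (σ : absoluteGaloisGroup K) (φ : TateDual K (TateDual K B p) p),
      (ρB.tateDual p).tateDual p σ φ = φ := tateDual_apply_eq_self_of_trivial p (ρB.tateDual p) hBD hμ
  have hcardBDD : Nat.card (TateDual K (TateDual K B p) p) = p :=
    (HomCarrier.natCard_eq (muEquivZMod K p) hpBD).trans hcardBD
  haveI : Finite (TateDual K A p) := DiscreteGaloisModule.TateDual.finite K A p
  haveI : Finite (TateDual K (TateDual K B p) p) := DiscreteGaloisModule.TateDual.finite K (TateDual K B p) p
  -- the large sets of places
  obtain ⟨S₁, hSS₁, hS₁⟩ := exists_finset_h1_eq_zero_of_trivial hζ (ρA.tateDual p) hAD hcardAD S hSinf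
  obtain ⟨S₂, hSS₂, hS₂⟩ := exists_finset_h1_eq_zero_of_trivial hζ ((ρB.tateDual p).tateDual p) hBDD hcardBDD
    S hSinf
  -- Milne I 4.10(b) at `S' = S₁ ∪ S₂`, then at `S`
  have hSS' : S ⊆ S₁ ∪ S₂ := fun v hv => Finset.mem_union_left _ (hSS₁ hv)
  have h1S' : S₁ ⊆ S₁ ∪ S₂ := Finset.subset_union_left
  have h2S' : S₂ ⊆ S₁ ∪ S₂ := Finset.subset_union_right
  have hS' : ∀ v : HeightOneSpectrum (𝓞 K), (Sum.inr v : Place K) ∉ S₁ ∪ S₂ →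
      ((p : ℕ) : 𝓞 K) ∉ v.asIdeal ∧ GaloisRep.IsUnramifiedAt v ρ := fun v hv => hS v fun h' => hv (hSS' h')
  -- unramifiedness of the trivial pieces, the dual maps
  have hurA : ∀ v : HeightOneSpectrum (𝓞 K), GaloisRep.IsUnramifiedAt v ρA := fun v => by
    rw [GaloisRep.isUnramifiedAt_iff_toLocal_holds]
    intro σ _
    exact DFunLike.ext _ _ fun a => hA _ a
  have hurB : ∀ v : HeightOneSpectrum (𝓞 K), GaloisRep.IsUnramifiedAt v ρB := fun v => by
    rw [GaloisRep.isUnramifiedAt_iff_toLocal_holds]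
    intro σ _
    exact DFunLike.ext _ _ fun b => hB _ b
  obtain ⟨gD, hgD⟩ := exists_tateDual_precomp_intertwining p g
  obtain ⟨fD, hfD⟩ := exists_tateDual_precomp_intertwining p f
  refine middleExact_canonical_of_superset ρ hpM hSS' hSinf hS ?_ t horth
  intro t' horth'
  have hSinf' : ∀ w : InfinitePlace K, (Sum.inl w : Place K) ∈ S₁ ∪ S₂ := fun w => hSS' (hSinf w)
  have hS'' : ∀ v : HeightOneSpectrum (𝓞 K), (Sum.inr v : Place K) ∉ S₁ ∪ S₂ →
      ((p : ℕ) : 𝓞 K) ∉ v.asIdeal ∧ GaloisRep.IsUnramifiedAt v ρA ∧ GaloisRep.IsUnramifiedAt v ρ ∧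
        GaloisRep.IsUnramifiedAt v ρB := fun v hv => ⟨(hS' v hv).1, hurA v, (hS' v hv).2, hurB v⟩
  exact middleExact_canonical_of_extension h hpA hpM gD hgD fD hfD hSinf' hS''
    (fun S'' hSS'' t'' horth'' => middleExact_canonical_of_trivial_of_card_eq_real ρA hA hcardA S''
      (fun w => hSS'' (hSinf' w)) (fun v hv => (hS' v fun h' => hv (hSS'' h')).1) t'' horth'')
    (fun t'' horth'' => middleExact_canonical_of_trivial_of_card_eq_real ρB hB hcardB (S₁ ∪ S₂) hSinf'
      (fun v hv => (hS' v hv).1) t'' horth'')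
    (fun S'' hSS'' t'' horth'' => middleExact_canonical_of_trivial_of_card_eq_real (ρB.tateDual p) hBD hcardBD
      S'' (fun w => hSS'' (hSinf' w)) (fun v hv => (hS' v fun h' => hv (hSS'' h')).1) t'' horth'')
    (sha_two_eq_zero_of_trivial_of_card_eq hζ ρA hA hcardA)
    (sha_two_tateDual_eq_zero_of_trivial_of_card_eq hζ ρB hB hpB hcardB)
    (hS₁ (S₁ ∪ S₂) h1S') (hS₂ (S₁ ∪ S₂) h2S') t' horth'

end Summit.BirchSwinnertonDyer.BirchSwinnertonDyer.Theorems.SignedEC.MuReal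

end
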